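import Mathlib
import HarnessLib
import Summits.RiemannHypothesis.RiemannHypothesis.Theses.WeilParity

/-!
# Route WeilParity: the assembly (item 15437)

`Assembly` (stmt-RiemannHypothesis-15437): `EvenSectorWins → OffLineParityDetection → RH` — given a
nontrivial zero `s` of `ζ` (Mathlib's binder), `riemannXi_eq_zero_of_nontrivial` +
`riemannXi_eq_zero_iff_holds` put it in the open strip; if `Re s ≠ 1/2`, detection yields a window
`a`, an odd normalised test `o` and a margin `m > 0` below every even normalised test, while
`EvenSectorWins` yields an even test within `m/2` of `o` — contradiction (the argument of the
route's deciding theorem `closes`, with the thesis in place of the two ranges; recorded as proved in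
the planner's Sketch.lean).  Axioms: propext, Classical.choice, Quot.sound.
-/

namespace Summit.RiemannHypothesis.RiemannHypothesis.Theorems.WeilParity

open Summit.RiemannHypothesis.RiemannHypothesis.Theses.WeilParity

/-- **Item stmt-RiemannHypothesis-15437** (`Assembly`): `EvenSectorWins → OffLineParityDetection →
RiemannHypothesis`. An off-line nontrivial zero would give a window where some odd normalised test
beats every even normalised test by a margin `m > 0`, contradicting `EvenSectorWins` at `δ = m/2`.
[cite: Bombieri2000Weil, Thm 2 (explicit formula setting); Weil1952] -/
theorem assembly_proof :
    Summit.RiemannHypothesis.RiemannHypothesis.Theses.WeilParity.Assembly := by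
  intro hWins hDet
  show _root_.RiemannHypothesis
  intro s hzeta htriv hone
  have hxi := _root_.Literature.NumberTheory.LFunctions.riemannXi_eq_zero_of_nontrivial hzeta htriv hone
  obtain ⟨-, h0, h1⟩ :=
    (_root_.Literature.NumberTheory.LFunctions.riemannXi_eq_zero_iff_holds s).1 hxi
  by_contra hne
  obtain ⟨a, ha, o, ho, hos, hodd, hon, m, hm, hdet⟩ := hDet s hzeta h0 h1 hne
  obtain ⟨e, he, hes, hev, hen, hle⟩ := hWins a ha o ho hos hodd hon (m / 2) (by linarith)
  have h := hdet e he hes hev hen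
  linarith

end Summit.RiemannHypothesis.RiemannHypothesis.Theorems.WeilParity
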